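import Summits.ResolutionOfSingularities.ResolutionOfSingularities.Theorems.MarkedTransferCampaignW12SandwichF2Cell
import Mathlib.Algebra.Order.Floor.Div
import HarnessLib

/-!
# [OURS · L1 G1 · scored cell F2 `mul_mem` × SW / SWρ] KERNEL AT GENERAL `m`: the product rule for the Frobenius-sandwich
# negative pieces holds at the guarded affine-line model iff `q = 2 ∣ m` (res-type-017 gen 5, cell owner of record per
# res-D-plan-1 ROUTING #12 (a) / #13 (c); scorer res-adj-1; sequel to `MarkedTransferCampaignW12SandwichF2Cell.lean` rev. 2 p492104)

WHAT IS DECIDED (a SCORED-CELL kernel about OURS objects, NOT a verdict). res-adj-1 SCORES DELTA 3 (1) 2026-08-27T03:35:24Z words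
the cell «F2-mul × SW: ✓ iff q ∣ m at the model (hand for general m; kernel at m ∈ {2,3})». This file makes the GENERAL-`m`
dichotomy kernel at the SAME guarded model `A = 𝔽₂[x]`, `P j = (x)^j` (`F2CellSW.isCharFiltration_P`), `p = 2`, `e = 1`, for every
Def-5.1 integer `m > 0`, for the W1.2 value `T_m(−a) := Campaign.sandwichPNega 2 1 P m a` (SW) and its value-type variant
`T_{ρ,m}(−a) := Campaign.sandwichPNegaRho 2 1 P m a` (SWρ):
* EVEN `m`: `T_m(−a) = (x^{κ_m(a)})` exactly, `κ_m(a) = m·⌈max(a,1)/m⌉` (upper bound: every live source `P(dm) = (x^{dm})` is an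
  even power `ρ(x^{dm/2})·A`, stable under sandwich operators; lower bound: the identity at `d = ⌈max(a,1)/m⌉`); the V3 field
  `mul_mem` HOLDS for `tildeM m` (positive degrees by fiat `P i`) in all four sign cases because `κ_m` is monotone and subadditive;
  the SWρ module pieces coincide with the ideal pieces AS SETS (multiplications are order-`0` sandwich operators).
* ODD `m`: `x^{m−1} = ∂(x^m) ∈ T_m(−m)` (`m ≡ 1` in `𝔽₂`) and `x^{2m−2} ∉ (x^{2m}) ⊇ T_m(−2m)` (live summands have `d ≥ 2`), so
  `mul_mem` FAILS at `i = j = −m`; the same witness lives in the SWρ module (`hasseDeriv_mem_sandwichPNegaRho`).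
Headlines `F2_mul_mem_SW_iff` / `F2_mul_mem_SWrho_iff : (… mul_mem …) ↔ Even m` (`0 < m`). Rev. 1/2 of the parent file are the
instances `m = 3` (✗) and `m = 2` (✓); `Tm 3 = T`, `Tm 2 = T2`, `Tmρ 3 = Tρ`, `kappa 2 = texp` pointwise.

HONEST FRAMING. A MODEL DICHOTOMY (one variable, `q = 2`), not the product rule for SW in general and not a reading of Def 5.1
(p.25 L31–L44) / Lem 5.8 (p.28 L7–L17) of H. Hironaka's manuscript (2017-03-23, [Hironaka2017], lit key `paper:url-3343fd9e678b`),
which enter only as the typed SHAPES the OURS objects replace, CANDIDATES [claim: Hironaka2017, status: under-review]; nothing of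
the manuscript is asserted; the scorer's F2 word and reading call (p.26 L24 / p.28 L4–L6: may `m` be taken in `qℤ`?) are
unchanged by it. `Tm`, `Tmρ`, `kappa`, `tildeM`, `nexpM`, `tildeMρ` are MODEL DATA, not OURS decls of record. AI proof, weaker than
expert review; nothing here is progress on resolution of singularities in positive characteristic; no claim beyond the kernel.
-/

noncomputable section

open MvPolynomial
open Literature.AlgebraicGeometry.Resolution
open Literature.AlgebraicGeometry.Hironaka2017
open Summit.ResolutionOfSingularities.ResolutionOfSingularities.Theorems.Campaign
open Summit.ResolutionOfSingularities.ResolutionOfSingularities.Theorems.Campaign.W12 (apply_mem_sandwichPNega)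

set_option linter.dupNamespace false -- mandated namespace of this single-conjunct summit

namespace Summit.ResolutionOfSingularities.ResolutionOfSingularities.Theorems.Campaign.W12.F2CellSW

/-- `T_m(−a)` for the model at a GENERAL Def-5.1 integer `m` (`p = 2`, `e = 1`; `T = Tm 3`, `T2 = Tm 2` by `rfl`).
MODEL DEFINITION, not an OURS decl of record. [folklore] -/
abbrev Tm (m a : ℕ) : Ideal A := sandwichPNega (O := A) 2 1 P m a

/-- `x^u ∉ (x^v)` in `𝔽₂[x]` for `u < v` (degrees, via `aeval` to `Polynomial`). [folklore] -/
theorem X_pow_not_mem_span_X_pow {u v : ℕ} (huv : u < v) :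
    (X 0 : A) ^ u ∉ Ideal.span {(X 0 : A) ^ v} := by
  intro h
  obtain ⟨g, hg⟩ := Ideal.mem_span_singleton'.mp h
  have hdvd : (Polynomial.X : Polynomial (ZMod 2)) ^ v ∣ Polynomial.X ^ u := by
    have h' := congrArg (MvPolynomial.aeval (R := ZMod 2) fun _ : Fin 1 => (Polynomial.X : Polynomial (ZMod 2))) hg
    simp only [map_mul, map_pow, MvPolynomial.aeval_X] at h'
    exact ⟨_, by rw [← h', mul_comm]⟩
  have hdeg := Polynomial.natDegree_le_of_dvd hdvd (pow_ne_zero u Polynomial.X_ne_zero)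
  rw [Polynomial.natDegree_X_pow, Polynomial.natDegree_X_pow] at hdeg
  omega

/-- **Upper-bound schema for `T_m(−c)`** (`0 < m`): if every summand index `d ≥ 1` of Eq. (36) re-based that is live at
degree `−c` (`c ≤ dm`) has its source exponent `dm` bounded below by an EVEN number `2n ≥ N`, then `T_m(−c) ⊆ (x^N)` —
the source piece `P(dm) ⊆ (x^{2n}) = ρ(x^n)·A` is stable under every sandwich operator (`apply_mem_span_X_pow_even`).
[folklore] -/
theorem Tm_le_span {m c N : ℕ} (hm : 0 < m)
    (h : ∀ d : ℕ, 1 ≤ d → c ≤ d * m → ∃ n, N ≤ 2 * n ∧ 2 * n ≤ d * m) :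
    Tm m c ≤ Ideal.span {(X 0 : A) ^ N} := by
  unfold Tm sandwichPNega S05NegativePart.pNega S05NegativePart.pTildeNeg
  refine iSup₂_le fun d hd => ?_
  rw [Nat.abs_cast] at hd
  unfold S05NegativePart.DD S05NegativePart.pPosi
  split_ifs with h0
  · rw [diffIdeal_bot]; exact bot_le
  · have hd1 : (1 : ℤ) ≤ d := by
      by_contra hlt
      apply h0
      have hm' : (0 : ℤ) ≤ (m : ℕ) := by positivity
      have : d * (m : ℕ) ≤ 0 := by nlinarith
      exact Int.toNat_of_nonpos this
    obtain ⟨d', rfl⟩ : ∃ d' : ℕ, d = (d' : ℤ) := ⟨d.toNat, (Int.toNat_of_nonneg (by omega)).symm⟩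
    have hcast : ((d' : ℤ) * (m : ℕ)).toNat = d' * m := by
      rw [show ((d' : ℤ) * (m : ℕ)) = ((d' * m : ℕ) : ℤ) by push_cast; ring, Int.toNat_natCast]
    rw [hcast]
    have hd1' : 1 ≤ d' := by exact_mod_cast hd1
    have hc : c ≤ d' * m := by exact_mod_cast hd
    obtain ⟨n, hNn, hnd⟩ := h d' hd1' hc
    refine (diffIdeal_le_iff _).mpr fun D _ f hf => ?_
    have hf' : f ∈ Ideal.span {(X 0 : A) ^ (2 * n)} := by
      have hle : P (d' * m) ≤ P (2 * n) := Ideal.pow_le_pow_right hnd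
      rw [← P_eq_span]; exact hle hf
    exact Ideal.span_singleton_le_span_singleton.mpr (pow_dvd_pow _ hNn) (apply_mem_span_X_pow_even D n hf')

/-- **Lower-bound schema for `T_m(−a)`**: the identity is a sandwich operator (order `0 ≤ km + a`) at any live summand
`d = k ≥ 1` (`a ≤ km`), so `x^{km} ∈ P(km)` lies in `T_m(−a)`. [folklore] -/
theorem X_pow_mem_Tm {m a k : ℕ} (hm : 0 < m) (hk : 0 < k) (ha : a ≤ k * m) :
    (X 0 : A) ^ (k * m) ∈ Tm m a := by
  have hmem := apply_mem_sandwichPNega (O := A) 2 1 P m a k ha (Nat.mul_pos hk hm).ne'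
    (D := LinearMap.id) ((isDiffOpLE_id (R := ↥(iterateFrobenius A 2 1).range) (A := A)).of_le (Nat.zero_le _))
    (f := (X 0 : A) ^ (k * m)) (X_pow_mem_P _)
  simpa using hmem

/-! ### Even `m` (`q = 2 ∣ m`): exact shape of the pieces and the product rule ✓ -/

/-- `κ_m(c) = m·⌈max(c,1)/m⌉`, the least POSITIVE multiple of `m` that is `≥ c` (Mathlib's ceiling division `⌈/⌉`).
MODEL ARITHMETIC. [folklore] -/
def kappa (m c : ℕ) : ℕ := m * (max c 1 ⌈/⌉ m)

/-- `max(c,1) ≤ κ_m(c)` (`0 < m`). [folklore] -/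
theorem max_le_kappa {m : ℕ} (hm : 0 < m) (c : ℕ) : max c 1 ≤ kappa m c := by
  unfold kappa
  simpa [smul_eq_mul] using le_smul_ceilDiv (a := m) (b := max c 1) hm

/-- Minimality: `κ_m(c) ≤ m·k` whenever `max(c,1) ≤ m·k` (`0 < m`). [folklore] -/
theorem kappa_le_mul {m : ℕ} (hm : 0 < m) {c k : ℕ} (h : max c 1 ≤ m * k) : kappa m c ≤ m * k :=
  Nat.mul_le_mul_left _ ((ceilDiv_le_iff_le_mul hm).2 h)

/-- `κ_m` is monotone. [folklore] -/
theorem kappa_mono {m : ℕ} (hm : 0 < m) {c c' : ℕ} (h : c ≤ c') : kappa m c ≤ kappa m c' :=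
  kappa_le_mul hm ((max_le_max h le_rfl).trans (max_le_kappa hm c'))

/-- `κ_m` is subadditive. [folklore] -/
theorem kappa_add_le {m : ℕ} (hm : 0 < m) (c c' : ℕ) : kappa m (c + c') ≤ kappa m c + kappa m c' := by
  have h1 := max_le_kappa hm c
  have h2 := max_le_kappa hm c'
  have key : max (c + c') 1 ≤ m * (max c 1 ⌈/⌉ m + max c' 1 ⌈/⌉ m) := by
    unfold kappa at h1 h2
    rw [mul_add]
    omega
  calc kappa m (c + c') ≤ m * (max c 1 ⌈/⌉ m + max c' 1 ⌈/⌉ m) := kappa_le_mul hm key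
    _ = kappa m c + kappa m c' := by unfold kappa; ring

/-- The ceiling quotient `⌈max(a,1)/m⌉` is positive (`0 < m`). [folklore] -/
theorem ceilDiv_max_pos {m : ℕ} (hm : 0 < m) (a : ℕ) : 0 < max a 1 ⌈/⌉ m := by
  by_contra h
  have h0 : max a 1 ⌈/⌉ m = 0 := by omega
  have := max_le_kappa hm a
  rw [kappa, h0, mul_zero] at this
  omega

/-- **`T_m(−a) = (x^{κ_m(a)})` exactly for EVEN `m > 0`**: upper bound because every live source `P(dm) = (x^{dm})` is an
even power, hence a sandwich constant times `A`, with `dm ≥ κ_m(a)`; lower bound by the identity at `d = ⌈max(a,1)/m⌉`.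
(Rev. 2's `T2_eq` is the case `m = 2`, `κ_2(a) = texp a`.) [folklore] -/
theorem Tm_eq_of_even {m : ℕ} (hm : Even m) (h0 : 0 < m) (a : ℕ) :
    Tm m a = Ideal.span {(X 0 : A) ^ kappa m a} := by
  apply le_antisymm
  · refine Tm_le_span h0 fun d hd hda => ?_
    obtain ⟨n', hn'⟩ := hm
    refine ⟨n' * d, ?_, ?_⟩
    · have hmax : max a 1 ≤ m * d := by
        refine max_le (by rw [mul_comm]; exact hda) ?_
        exact Nat.one_le_iff_ne_zero.mpr (Nat.mul_pos h0 hd).ne'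
      calc kappa m a ≤ m * d := kappa_le_mul h0 hmax
        _ = 2 * (n' * d) := by rw [hn']; ring
    · rw [hn']
      apply le_of_eq
      ring
  · rw [Ideal.span_singleton_le_iff_mem]
    have hk0 := ceilDiv_max_pos h0 a
    have hle : a ≤ (max a 1 ⌈/⌉ m) * m := by
      have := max_le_kappa h0 a
      unfold kappa at this
      rw [mul_comm]
      exact le_of_max_le_left this
    have hmem := X_pow_mem_Tm h0 hk0 hle
    rwa [mul_comm] at hmem

/-- The SW candidate value at the model for general `m`: positive degrees BY FIAT `P i`, non-positive degrees the sandwich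
pieces `T_m(−i)`. MODEL DEFINITION (`tilde2 = tildeM 2`). [folklore] -/
def tildeM (m : ℕ) (i : ℤ) : Ideal A := if 0 < i then P i.toNat else Tm m (-i).toNat

/-- The exponent of the monomial generating `tildeM m i` when `m` is even. MODEL DEFINITION. [folklore] -/
def nexpM (m : ℕ) (i : ℤ) : ℕ := if 0 < i then i.toNat else kappa m (-i).toNat

/-- `tildeM m i = (x^{nexpM m i})` for even `m > 0`. [folklore] -/
theorem tildeM_eq_of_even {m : ℕ} (hm : Even m) (h0 : 0 < m) (i : ℤ) :
    tildeM m i = Ideal.span {(X 0 : A) ^ nexpM m i} := by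
  unfold tildeM nexpM
  split_ifs
  · exact P_eq_span _
  · exact Tm_eq_of_even hm h0 _

/-- **The exponent inequality behind `mul_mem`**, all four sign cases: `nexpM m (i + j) ≤ nexpM m i + nexpM m j`
(`0 < m`; monotonicity and subadditivity of `κ_m`). [folklore] -/
theorem nexpM_add_le {m : ℕ} (h0 : 0 < m) (i j : ℤ) : nexpM m (i + j) ≤ nexpM m i + nexpM m j := by
  unfold nexpM
  by_cases hi : 0 < i <;> by_cases hj : 0 < j
  · rw [if_pos hi, if_pos hj, if_pos (by omega)]
    omega
  · by_cases hij : 0 < i + j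
    · rw [if_pos hi, if_neg hj, if_pos hij]
      omega
    · rw [if_pos hi, if_neg hj, if_neg hij]
      have hmono := kappa_mono h0 (show (-(i + j)).toNat ≤ (-j).toNat by omega)
      omega
  · by_cases hij : 0 < i + j
    · rw [if_neg hi, if_pos hj, if_pos hij]
      omega
    · rw [if_neg hi, if_pos hj, if_neg hij]
      have hmono := kappa_mono h0 (show (-(i + j)).toNat ≤ (-i).toNat by omega)
      omega
  · rw [if_neg hi, if_neg hj, if_neg (by omega)]
    have hsub := kappa_add_le h0 (-i).toNat (-j).toNat
    have heq : (-(i + j)).toNat = (-i).toNat + (-j).toNat := by omega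
    rw [heq]
    exact hsub

/-- **F2 `mul_mem` ✓ for SW at the guarded model for every EVEN `m > 0`** (`q = 2 ∣ m`), in the shape of the V3 field:
`a ∈ tildeM m i`, `b ∈ tildeM m j` ⇒ `a·b ∈ tildeM m (i + j)` for all `i j : ℤ`. A MODEL STATEMENT (one variable,
`p = 2`, `e = 1`), not the product rule for SW in general. [folklore] -/
theorem F2_mul_mem_SW_holds_of_even {m : ℕ} (hm : Even m) (h0 : 0 < m) (i j : ℤ) (a b : A)
    (ha : a ∈ tildeM m i) (hb : b ∈ tildeM m j) : a * b ∈ tildeM m (i + j) := by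
  rw [tildeM_eq_of_even hm h0] at ha hb ⊢
  have hab : a * b ∈ Ideal.span {(X 0 : A) ^ (nexpM m i + nexpM m j)} := by
    rw [pow_add, ← Ideal.span_singleton_mul_span_singleton]
    exact Ideal.mul_mem_mul ha hb
  exact Ideal.span_singleton_le_span_singleton.mpr (pow_dvd_pow _ (nexpM_add_le h0 i j)) hab

/-! ### Odd `m` (`q = 2 ∤ m`): the witness `x^{m−1} = ∂(x^m)` and the product rule ✗ -/

/-- An odd natural number is `1` in `A = 𝔽₂[x]`. [folklore] -/
theorem natCast_eq_one_of_odd {m : ℕ} (hm : Odd m) : ((m : ℕ) : A) = 1 := by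
  obtain ⟨k, rfl⟩ := hm
  rw [Nat.cast_add, Nat.cast_mul, CharP.cast_eq_zero A 2, zero_mul, zero_add, Nat.cast_one]

/-- **`x^{m−1} ∈ T_m(−a)` for odd `m` and `a ≤ m`**: the summand `d = 1`, the sandwich operator `∂ = ∂^{(1)}` (order
`1 ≤ m + a`) applied to `x^m ∈ P m`: `∂(x^m) = m·x^{m−1} = x^{m−1}` (`m` odd). [folklore] -/
theorem X_pow_pred_mem_Tm_of_odd {m : ℕ} (hm : Odd m) {a : ℕ} (ha : a ≤ m) : (X 0 : A) ^ (m - 1) ∈ Tm m a := by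
  classical
  have hγ : ∀ i : Fin 1, (Finsupp.single (0 : Fin 1) 1) i < 2 ^ 1 := by intro i; fin_cases i; simp
  obtain ⟨D, hD, hDf⟩ := W12.exists_sandwichOp_hasseDeriv (R := ZMod 2) (σ := Fin 1) 2 1 hγ
  have hdeg : (Finsupp.single (0 : Fin 1) 1).degree = 1 := by simp [Finsupp.degree_single]
  rw [hdeg] at hD
  have hm1 : 1 ≤ m := hm.pos
  have hmem := apply_mem_sandwichPNega (O := A) 2 1 P m a 1 (by omega) (by omega) (hD.of_le (by omega))
    (f := (X 0 : A) ^ (1 * m)) (X_pow_mem_P _)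
  rw [hDf, one_mul, hasseDeriv_X_pow, Nat.choose_one_right, natCast_eq_one_of_odd hm, one_mul] at hmem
  exact hmem

/-- **`T_m(−2m) ⊆ (x^{2m})`** (`0 < m`): the live summands have `d ≥ 2`, source `P(dm) ⊆ (x^{2m}) = ρ(x^m)·A`. [folklore] -/
theorem Tm_add_self_le {m : ℕ} (h0 : 0 < m) : Tm m (m + m) ≤ Ideal.span {(X 0 : A) ^ (2 * m)} :=
  Tm_le_span h0 fun _ _ hle => ⟨m, le_rfl, by omega⟩

/-- **F2 `mul_mem` ✗ for SW at the guarded model for every ODD `m`** (`q = 2 ∤ m`), degrees `i = j = −m` (the `m ∣ i` case):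
`x^{m−1} ∈ T_m(−m)` twice, `x^{m−1}·x^{m−1} = x^{2m−2} ∉ (x^{2m}) ⊇ T_m(−2m)`. (Rev. 1's `not_mul_le_div` is `m = 3`.)
[folklore] -/
theorem F2_mul_mem_SW_fails_of_odd {m : ℕ} (hm : Odd m) :
    ∃ a b : A, a ∈ Tm m m ∧ b ∈ Tm m m ∧ a * b ∉ Tm m (m + m) := by
  refine ⟨X 0 ^ (m - 1), X 0 ^ (m - 1), X_pow_pred_mem_Tm_of_odd hm le_rfl, X_pow_pred_mem_Tm_of_odd hm le_rfl,
    fun h => ?_⟩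
  rw [← pow_add] at h
  have hm1 : 1 ≤ m := hm.pos
  exact X_pow_not_mem_span_X_pow (by omega) (Tm_add_self_le hm.pos h)

/-- **THE CELL FOR GENERAL `m` (SW): F2 `mul_mem` holds at the guarded `𝔽₂[x]` model iff `q = 2 ∣ m`** (`0 < m`, Def 5.1's
`m > 0`), in the shape of the V3 field over `tildeM m`. Kernel form of res-type-017's hand remark of rev. 1 («`T(−c) =
(x^{q⌊m⌈c/m⌉/q⌋})`, so the product rule holds iff `q ∣ m`») at `q = 2`; rev. 1/2 are the instances `m = 3` (✗) and `m = 2`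
(✓). A MODEL STATEMENT, not a reading of Def 5.1; the scorer's F2 word is unchanged by it. [folklore] -/
theorem F2_mul_mem_SW_iff {m : ℕ} (h0 : 0 < m) :
    (∀ (i j : ℤ) (a b : A), a ∈ tildeM m i → b ∈ tildeM m j → a * b ∈ tildeM m (i + j)) ↔ Even m := by
  refine ⟨fun h => ?_, fun hm => F2_mul_mem_SW_holds_of_even hm h0⟩
  by_contra hodd
  rw [Nat.not_even_iff_odd] at hodd
  obtain ⟨a, b, ha, hb, hab⟩ := F2_mul_mem_SW_fails_of_odd hodd
  have hneg : tildeM m (-(m : ℤ)) = Tm m m := by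
    unfold tildeM; rw [if_neg (by omega)]; congr 1; omega
  have hneg2 : tildeM m (-(m : ℤ) + -(m : ℤ)) = Tm m (m + m) := by
    unfold tildeM; rw [if_neg (by omega)]; congr 1; omega
  have h' := h (-(m : ℤ)) (-(m : ℤ)) a b
  rw [hneg, hneg2] at h'
  exact hab (h' ha hb)

/-! ### The same dichotomy for the value-type variant SWρ (`Campaign.sandwichPNegaRho`, `ρ`-modules) -/

/-- `T_{ρ,m}(−a)` for the model at a general `m`: the `ρ`-MODULE pieces of SWρ (`p = 2`, `e = 1`; `Tρ = Tmρ 3`).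
MODEL DEFINITION. [folklore] -/
abbrev Tmρ (m a : ℕ) : Submodule (↥(iterateFrobenius A 2 1).range) A := sandwichPNegaRho (O := A) 2 1 P m a

/-- `T_{ρ,m}(−c) ⊆ T_m(−c)` as sets (`sandwichPNegaRho_subset`). [folklore] -/
theorem Tmρ_subset (m c : ℕ) : (Tmρ m c : Set A) ⊆ (Tm m c : Set A) :=
  sandwichPNegaRho_subset (O := A) 2 1 P m c

/-- Values of sandwich operators of order `≤ dm + a` on `P(dm)` (`dm ≠ 0`, `a ≤ dm`) lie in the MODULE `T_{ρ,m}(−a)` — the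
generator values of `sandwichDDRho` at the summand `d` (the pattern of `hasseDeriv_mem_sandwichPNegaRho`, for an arbitrary
operator). [folklore] -/
theorem apply_mem_Tmρ {m a d : ℕ} (had : a ≤ d * m) (hdm : d * m ≠ 0)
    {D : A →ₗ[↥(iterateFrobenius A 2 1).range] A}
    (hD : IsDiffOpLE (↥(iterateFrobenius A 2 1).range) (d * m + a) D) {f : A} (hf : f ∈ P (d * m)) :
    D f ∈ Tmρ m a := by
  unfold Tmρ sandwichPNegaRho sandwichPTildeNegRho
  have hdm' : |(a : ℤ)| ≤ (d : ℤ) * m := by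
    rw [Nat.abs_cast]; exact_mod_cast had
  refine (le_iSup₂ (f := fun (d : ℤ) (_ : |(a : ℤ)| ≤ d * m) =>
    sandwichDDRho (O := A) 2 1 P m a d) (d : ℤ) hdm') ?_
  unfold sandwichDDRho
  refine Submodule.subset_span ⟨D, ?_, f, ?_, rfl⟩
  · have h2 : ((d : ℤ) * m + a).toNat = d * m + a := by
      rw [show ((d : ℤ) * m + a) = ((d * m + a : ℕ) : ℤ) by push_cast; ring, Int.toNat_natCast]
    rw [h2]
    exact hD
  · have h1 : ((d : ℤ) * m).toNat = d * m := by
      rw [show ((d : ℤ) * m) = ((d * m : ℕ) : ℤ) by push_cast; ring, Int.toNat_natCast]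
    rw [h1]
    simpa [S05NegativePart.pPosi, hdm] using hf

/-- **Lower bound inside the module**: `h·x^{κ_m(a)} ∈ T_{ρ,m}(−a)` for every `h ∈ A` (`0 < m`) — multiplication by `h` is a
sandwich operator of order `0`, applied to `x^{κ_m(a)} ∈ P(κ_m(a))` at the summand `d = ⌈max(a,1)/m⌉`. [folklore] -/
theorem mul_X_pow_kappa_mem_Tmρ {m : ℕ} (h0 : 0 < m) (a : ℕ) (h : A) :
    h * (X 0 : A) ^ kappa m a ∈ Tmρ m a := by
  have hk0 := ceilDiv_max_pos h0 a
  have hle : a ≤ (max a 1 ⌈/⌉ m) * m := by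
    have := max_le_kappa h0 a
    unfold kappa at this
    rw [mul_comm]
    exact le_of_max_le_left this
  have hmem := apply_mem_Tmρ hle (Nat.mul_pos hk0 h0).ne'
    ((isDiffOpLE_mulLeft (R := ↥(iterateFrobenius A 2 1).range) h).of_le (Nat.zero_le _))
    (f := (X 0 : A) ^ ((max a 1 ⌈/⌉ m) * m)) (X_pow_mem_P _)
  rw [LinearMap.mulLeft_apply, mul_comm (max a 1 ⌈/⌉ m) m] at hmem
  exact hmem

/-- **`T_{ρ,m}(−a) = (x^{κ_m(a)})` AS SETS for even `m > 0`**: the module and the ideal coincide at the model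
(`Tmρ_subset` + `Tm_eq_of_even`; `mul_X_pow_kappa_mem_Tmρ`). [folklore] -/
theorem Tmρ_coe_eq_of_even {m : ℕ} (hm : Even m) (h0 : 0 < m) (a : ℕ) :
    (Tmρ m a : Set A) = (Ideal.span {(X 0 : A) ^ kappa m a} : Set A) := by
  apply Set.Subset.antisymm
  · rw [← Tm_eq_of_even hm h0]
    exact Tmρ_subset m a
  · intro g hg
    obtain ⟨h, rfl⟩ := Ideal.mem_span_singleton'.mp hg
    exact mul_X_pow_kappa_mem_Tmρ h0 a h

/-- The SWρ candidate value at the model for general `m`, AS SETS: positive degrees by fiat `P i`, non-positive degrees the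
module pieces `T_{ρ,m}(−i)`. MODEL DEFINITION. [folklore] -/
def tildeMρ (m : ℕ) (i : ℤ) : Set A := if 0 < i then (P i.toNat : Set A) else (Tmρ m (-i).toNat : Set A)

/-- For even `m > 0` the SWρ value and the SW value coincide as sets. [folklore] -/
theorem tildeMρ_eq_of_even {m : ℕ} (hm : Even m) (h0 : 0 < m) (i : ℤ) : tildeMρ m i = (tildeM m i : Set A) := by
  unfold tildeMρ tildeM
  split_ifs
  · rfl
  · rw [Tmρ_coe_eq_of_even hm h0, Tm_eq_of_even hm h0]

/-- **F2 `mul_mem` ✓ for SWρ at the guarded model for every EVEN `m > 0`** (V3-field shape on the set-valued pieces).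
A MODEL STATEMENT. [folklore] -/
theorem F2_mul_mem_SWrho_holds_of_even {m : ℕ} (hm : Even m) (h0 : 0 < m) (i j : ℤ) (a b : A)
    (ha : a ∈ tildeMρ m i) (hb : b ∈ tildeMρ m j) : a * b ∈ tildeMρ m (i + j) := by
  rw [tildeMρ_eq_of_even hm h0] at ha hb ⊢
  exact F2_mul_mem_SW_holds_of_even hm h0 i j a b ha hb

/-- **`x^{m−1} ∈ T_{ρ,m}(−a)` for odd `m`, `a ≤ m`**: `x^{m−1} = ∂(x^m)` is a generator VALUE of the module
(`hasseDeriv_mem_sandwichPNegaRho`, summand `d = 1`). [folklore] -/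
theorem X_pow_pred_mem_Tmρ_of_odd {m : ℕ} (hm : Odd m) {a : ℕ} (ha : a ≤ m) : (X 0 : A) ^ (m - 1) ∈ Tmρ m a := by
  classical
  have hγ : ∀ i : Fin 1, (Finsupp.single (0 : Fin 1) 1) i < 2 ^ 1 := by intro i; fin_cases i; simp
  have hm1 : 1 ≤ m := hm.pos
  have hdeg : (Finsupp.single (0 : Fin 1) 1).degree ≤ 1 * m + a := by simp [Finsupp.degree_single]; omega
  have hmem := hasseDeriv_mem_sandwichPNegaRho (R := ZMod 2) (σ := Fin 1) 2 1 P m a 1 (by omega) (by omega) hγ hdeg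
    (f := (X 0 : A) ^ (1 * m)) (X_pow_mem_P _)
  rw [one_mul, hasseDeriv_X_pow, Nat.choose_one_right, natCast_eq_one_of_odd hm, one_mul] at hmem
  exact hmem

/-- **F2 `mul_mem` ✗ for SWρ at the guarded model for every ODD `m`**, degrees `i = j = −m`: the SW witness lives in the
module and `T_{ρ,m}(−2m) ⊆ T_m(−2m) ⊆ (x^{2m}) ∌ x^{2m−2}`. (Rev. 1's `F2_mul_mem_SWrho_fails` is `m = 3`.) [folklore] -/
theorem F2_mul_mem_SWrho_fails_of_odd {m : ℕ} (hm : Odd m) :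
    ∃ a b : A, a ∈ Tmρ m m ∧ b ∈ Tmρ m m ∧ a * b ∉ Tmρ m (m + m) := by
  refine ⟨X 0 ^ (m - 1), X 0 ^ (m - 1), X_pow_pred_mem_Tmρ_of_odd hm le_rfl, X_pow_pred_mem_Tmρ_of_odd hm le_rfl,
    fun h => ?_⟩
  have h' : (X 0 : A) ^ (m - 1) * X 0 ^ (m - 1) ∈ Tm m (m + m) := Tmρ_subset m (m + m) h
  rw [← pow_add] at h'
  have hm1 : 1 ≤ m := hm.pos
  exact X_pow_not_mem_span_X_pow (by omega) (Tm_add_self_le hm.pos h')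

/-- **THE CELL FOR GENERAL `m` (SWρ): F2 `mul_mem` holds at the guarded `𝔽₂[x]` model for the set-valued SWρ pieces iff
`q = 2 ∣ m`** (`0 < m`). A MODEL STATEMENT. [folklore] -/
theorem F2_mul_mem_SWrho_iff {m : ℕ} (h0 : 0 < m) :
    (∀ (i j : ℤ) (a b : A), a ∈ tildeMρ m i → b ∈ tildeMρ m j → a * b ∈ tildeMρ m (i + j)) ↔ Even m := by
  refine ⟨fun h => ?_, fun hm => F2_mul_mem_SWrho_holds_of_even hm h0⟩
  by_contra hodd
  rw [Nat.not_even_iff_odd] at hodd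
  obtain ⟨a, b, ha, hb, hab⟩ := F2_mul_mem_SWrho_fails_of_odd hodd
  have hneg : tildeMρ m (-(m : ℤ)) = (Tmρ m m : Set A) := by
    unfold tildeMρ; rw [if_neg (by omega)]; congr 2; omega
  have hneg2 : tildeMρ m (-(m : ℤ) + -(m : ℤ)) = (Tmρ m (m + m) : Set A) := by
    unfold tildeMρ; rw [if_neg (by omega)]; congr 2; omega
  have h' := h (-(m : ℤ)) (-(m : ℤ)) a b
  rw [hneg, hneg2] at h'
  exact hab (h' ha hb)

end Summit.ResolutionOfSingularities.ResolutionOfSingularities.Theorems.Campaign.W12.F2CellSW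

end
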